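import Summits.QuantumFields.YangMills.Theorems.LuscherReductionTwistedTraceScalingBOCentralTransfer
import Summits.QuantumFields.YangMills.Theorems.LuscherReductionTwistedTraceScalingToronCurl
import Summits.QuantumFields.YangMills.Theorems.LuscherReductionTwistedTraceScalingAxisRotation
import Summits.QuantumFields.YangMills.Theorems.LuscherReductionTwistedTraceScalingBOSliceCoreIndicators
import Summits.QuantumFields.YangMills.Theorems.LuscherReductionTwistedTraceScalingSlowShadow
import HarnessLib

/-!
# R51 (crux `TwistedTraceScaling`, stmt-QuantumFields-20203): the LOWER half of the landed (C1) central transfer `central_transfer_two_sided_chart`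
# (`…BOCentralTransfer`, 2026-08-29T05:22Z) is VACUOUS as stated — its support inclusion `hbo` and its window floor `hχlo` on the CRUDE window `5MKβ^{-s}` force `χ_lo = 0`

Standing disprover `ym-cdisprove-20203-1` (gen 41, cycle 41d).  Load-bearing analysis of two hypotheses of lane A's landed theorem
`Summit.QuantumFields.YangMills.Theorems.FemtoTransferGap.TwoLattice.ConstTube.central_transfer_two_sided_chart`:
* `hbo : ∀ U, boFun L χ₀ Ω_G U ≠ 0 → recordChi L s K M β U ≠ 0` — the BO test function built from the smearing amplitude `χ₀` and the fibre profile `Ω_G` is supported in the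
  record's fat tube, whose LINK radius is `MK·powScale s β` (`recordChi = recordWeightRho (K·powScale s) (MK·powScale s) (powScale 1)`, `fatTubeRho = nearOne ∩ {orbitDist < ·}`,
  `nearOne ρ = {∀ e, ‖U_e − 1‖_F < ρ}`);
* `hχlo : ∀ u, (∀ k, ‖q(u_k) − 1‖ ≤ 5MK·powScale s β) → S_W(u) ≤ 12(5MK·powScale s β)⁴ → χ_lo ≤ χ₀ u` — the window floor on the CRUDE window (five link radii).
The one-site configuration `u_t` with all three links `diagSU2(2·arcsin(t/2))`, `t = MK·powScale s β` (quaternion distance exactly `t` from `1`, zero action — commuting links) lies in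
the crude window, so `χ_lo ≤ χ₀(u_t)`; but `boFun χ₀ Ω_G (orthoTube u_t 0) = χ₀(u_t)·Ω_G(0)` (`Ω_G(0) ≠ 0` for the frozen profile with `r_f β > 0`), and `orthoTube u_t 0` has links
`u_t(0,k)` at Frobenius distance `≥ t` from `1`, i.e. NOT in `nearOne (MK·powScale s β)` — so `recordChi = 0` there, `hbo` gives `χ₀(u_t) = 0`, hence `χ_lo ≤ 0`; with `hχlo0 : 0 ≤ χ_lo`
the lower constant `lo = (…)·Z·χ_lo·(…)` of the theorem VANISHES.  Lane A's successor file `…BOLocalisedAvgChartLowerSharp` (05:36Z) records the same diagnosis in prose and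
replaces the crude floor by the SHARP window `a_W = O(KLβ^{-1/2}ℓ²)`; this file is the kernel certificate, with the threshold made explicit:
* ★★★ `chilo_nonpos_of_floor_window` — for ANY floor window radius `a ≥ MK·powScale s β` (`0 ≤ MK·powScale s β ≤ 2`), `hbo ∧ (Ω(0) ≠ 0) ∧ hχlo(a) ⇒ χ_lo ≤ 0`: the floor window
  must be STRICTLY INSIDE the record's link radius (the sharp `a_W` is, eventually; the crude `5MK·powScale s β` is not);
* ★★★ `chilo_eq_zero_of_crude_floor` — the instance `a = 5MK·powScale s β`, `Ω_G = frozenProfile L qf rf β` with `0 < rf β`, `0 ≤ χ_lo`: `χ_lo = 0` (hypotheses verbatim from the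
  landed theorem);
* helpers: `norm_su2Quat_diagSU2_sub_one_sq` (`‖q(diagSU2 φ) − 1‖² = 2 − 2cos φ`), `norm_su2Quat_diagSU2_arcsin` (distance exactly `t ∈ [0,2]`), `mem_nearOne_of_recordChi_ne_zero`.
READING (numbers, not adjectives): a window floor is informative only on radii `a < MK·powScale s β`; together with R50/R50T the smearing window `δu` of `χ₀` is pinned to
`a ≤ δu` (floor) and — by the same support inclusion applied to `χ₀` itself, `hχw` — `δu`-configurations must stay inside `nearOne(MK·powScale s β)`, while (OD) wants `δu = O(β^{-q})`,
`q > 1/6`: all compatible on the C4-CORE window since `a_W = O(β^{-1/2}·polylog) ≪ MKβ^{-s} ≪ β^{-1/6}`.  NO KILL: a vacuous lower half of one landed brick, repaired next door.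
HONEST FRAMING: statics about hypotheses of a brick of a stub of a child of the CONDITIONAL reduction route R2b1; not infinite volume, not a gap, not Clay.
-/

set_option autoImplicit false

noncomputable section

open Real
open Literature.MathematicalPhysics.QuantumFieldTheory hiding SU2
open Literature.MathematicalPhysics.QuantumLattice
open Summit.QuantumFields.YangMills.Theorems.FemtoTransferGap
open Summit.QuantumFields.YangMills.Theorems.FemtoTransferGap.TwoLattice
open Summit.QuantumFields.YangMills.Theorems.FemtoTransferGap.TwoLattice.ConstTube
open Summit.QuantumFields.YangMills.Theorems.FemtoTransferGap.TwoLattice.Toron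
open Summit.QuantumFields.YangMills.Theorems.FemtoTransferGap.TwoLattice.Flat
open Summit.QuantumFields.YangMills.Theorems.FemtoTransferGap.TwoLattice.Stiff (LinkSpace)

namespace Summit.QuantumFields.YangMills.Theorems.TwistedTraceScaling.Negative.R51

variable {L : ℕ} [NeZero L]

/-! ## §1 An `SU(2)` element at prescribed quaternion distance from `1` -/

omit [NeZero L] in
/-- `‖q(diagSU2 φ) − 1‖² = 2 − 2cos φ`. [folklore] -/
theorem norm_su2Quat_diagSU2_sub_one_sq (φ : ℝ) : ‖su2Quat (diagSU2 φ) - 1‖ ^ 2 = 2 - 2 * Real.cos φ := by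
  rw [norm_su2Quat_sub_one_sq, scalarPart_diagSU2, vecPart_diagSU2]
  simp [Fin.sum_univ_three]
  nlinarith [Real.sin_sq_add_cos_sq φ]

omit [NeZero L] in
/-- For `t ∈ [0, 2]`, `diagSU2 (2·arcsin(t/2))` is at quaternion distance exactly `t` from `1`. [folklore] -/
theorem norm_su2Quat_diagSU2_arcsin {t : ℝ} (h0 : 0 ≤ t) (h2 : t ≤ 2) : ‖su2Quat (diagSU2 (2 * Real.arcsin (t / 2))) - 1‖ = t := by
  have hs : Real.sin (Real.arcsin (t / 2)) = t / 2 := Real.sin_arcsin (by linarith) (by linarith)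
  have hcos : Real.cos (2 * Real.arcsin (t / 2)) = 1 - 2 * (t / 2) ^ 2 := by
    rw [Real.cos_two_mul, Real.cos_sq', hs]; ring
  have hsq : ‖su2Quat (diagSU2 (2 * Real.arcsin (t / 2))) - 1‖ ^ 2 = t ^ 2 := by
    rw [norm_su2Quat_diagSU2_sub_one_sq, hcos]; ring
  have hn : 0 ≤ ‖su2Quat (diagSU2 (2 * Real.arcsin (t / 2))) - 1‖ := norm_nonneg _
  nlinarith [hsq, hn, h0]

/-! ## §2 The record weight lives in `nearOne (MK·powScale s β)` -/

/-- `recordChi s K M β U ≠ 0 ⇒ U ∈ nearOne (MK·powScale s β)` (the indicator of the fat tube). [folklore] -/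
theorem mem_nearOne_of_recordChi_ne_zero {s K M β : ℝ} {U : GaugeConfig 3 L SU2} (h : recordChi L s K M β U ≠ 0) :
    U ∈ nearOne L (M * (K * powScale s β)) := by
  by_contra hU
  apply h
  unfold recordChi recordWeightRho
  rw [Set.indicator_of_notMem (fun hmem => hU hmem.1), zero_mul]

/-! ## §3 The floor window must be strictly inside the record's link radius -/

/-- ★★★ **A WINDOW FLOOR ON RADIUS `a ≥ MK·powScale s β` IS VACUOUS.**  If the BO test function `boFun χ₀ Ω` is supported where `recordChi ≠ 0` (`hbo` of
`central_transfer_two_sided_chart`), `Ω(0) ≠ 0`, and the floor `χ_lo ≤ χ₀ u` is asked for every one-site `u` with `‖q(u_k) − 1‖ ≤ a` (all `k`) and `S_W(u) ≤ 12a⁴`, where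
`MK·powScale s β ≤ a` and `0 ≤ MK·powScale s β ≤ 2`, then `χ_lo ≤ 0`.  Witness: all links `diagSU2(2arcsin(t/2))`, `t = MK·powScale s β`. [cite: Luscher1983, §3] -/
theorem chilo_nonpos_of_floor_window {s K M β a : ℝ} {χ₀ : GaugeConfig 3 1 SU2 → ℝ} {Ω : LinkSpace L → ℝ}
    (hbo : ∀ U, boFun L χ₀ Ω U ≠ 0 → recordChi L s K M β U ≠ 0) (hΩ0 : Ω 0 ≠ 0) {χlo : ℝ}
    (hχlo : ∀ u : GaugeConfig 3 1 SU2, (∀ k : Fin 3, ‖su2Quat (u (0, k)) - 1‖ ≤ a) → wilsonAction su2Rep u ≤ 12 * a ^ 4 → χlo ≤ χ₀ u)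
    (h0 : 0 ≤ M * (K * powScale s β)) (ha : M * (K * powScale s β) ≤ a) (h2 : M * (K * powScale s β) ≤ 2) : χlo ≤ 0 := by
  set t := M * (K * powScale s β) with ht
  set u : GaugeConfig 3 1 SU2 := abelianCfg 1 (fun _ => 2 * Real.arcsin (t / 2)) with hu
  have hnorm : ∀ k : Fin 3, ‖su2Quat (u (0, k)) - 1‖ = t := fun k => norm_su2Quat_diagSU2_arcsin h0 h2
  have hS : wilsonAction su2Rep u = 0 := wilsonAction_abelianCfg (L := 1) _
  have ha0 : 0 ≤ a := h0.trans ha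
  have hle : χlo ≤ χ₀ u := hχlo u (fun k => (hnorm k).le.trans ha) (by rw [hS]; positivity)
  suffices hz : χ₀ u = 0 by rw [hz] at hle; exact hle
  by_contra hne
  have hbf : boFun L χ₀ Ω (orthoTube L u 0) ≠ 0 := by
    rw [boFun_orthoTube L χ₀ Ω u (zero_mem_capBalancedSet L), map_zero]
    exact mul_ne_zero hne hΩ0
  have hnear := mem_nearOne_of_recordChi_ne_zero (hbo _ hbf)
  obtain ⟨e⟩ : Nonempty (Edge 3 L) := ⟨((fun _ => 0), 0)⟩
  have hlt : frobNorm (((orthoTube L u 0 e : SU2) : Matrix (Fin 2) (Fin 2) ℂ) - 1) < t := hnear e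
  have he : orthoTube L u 0 e = u (0, e.2) := by
    rw [orthoTube_apply, Pi.zero_apply, chartSU2_zero', one_mul]
  rw [he] at hlt
  have hq := norm_su2Quat_sub_le (u (0, e.2)) 1
  rw [su2Quat_one] at hq
  have h1 : (((1 : SU2) : Matrix (Fin 2) (Fin 2) ℂ)) = 1 := rfl
  rw [h1] at hq
  have := hnorm e.2
  linarith

/-- ★★★ **THE LANDED INSTANCE: `χ_lo = 0`.**  With the hypotheses of `central_transfer_two_sided_chart` verbatim — `hbo` for the frozen profile `Ω_G = frozenProfile L qf rf β`
(`0 < rf β`), the crude floor `hχlo` on `5MK·powScale s β`, `hχlo0 : 0 ≤ χ_lo` — and `0 ≤ MK·powScale s β ≤ 2` (lane A's `hRb3` gives `≤ 1/9` for `L ≥ 2`): `χ_lo = 0`, so the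
lower constant `lo ∝ Z·χ_lo` of the landed two-sided estimate is `0`. [cite: Luscher1983, §3] -/
theorem chilo_eq_zero_of_crude_floor {s K M β : ℝ} {χ₀ : GaugeConfig 3 1 SU2 → ℝ} {qf : ℝ → LinkSpace L → ℝ} {rf : ℝ → ℝ} (hrf : 0 < rf β)
    (hbo : ∀ U, boFun L χ₀ (frozenProfile L qf rf β) U ≠ 0 → recordChi L s K M β U ≠ 0) {χlo : ℝ} (hχlo0 : 0 ≤ χlo)
    (hχlo : ∀ u : GaugeConfig 3 1 SU2, (∀ k : Fin 3, ‖su2Quat (u (0, k)) - 1‖ ≤ 5 * (M * (K * powScale s β))) →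
      wilsonAction su2Rep u ≤ 12 * (5 * (M * (K * powScale s β))) ^ 4 → χlo ≤ χ₀ u)
    (h0 : 0 ≤ M * (K * powScale s β)) (h2 : M * (K * powScale s β) ≤ 2) : χlo = 0 := by
  have hΩ0 : frozenProfile L qf rf β 0 ≠ 0 := frozenProfile_ne_zero_of_norm_lt qf rf β (by rwa [norm_zero])
  exact le_antisymm (chilo_nonpos_of_floor_window hbo hΩ0 hχlo h0 (by linarith) h2) hχlo0

/-- Consequently ANY non-negative quantity with the factor `χ_lo` — in particular the landed lower constant
`lo = (4C_L)^{-d}(1−KD·R₁²)(π/t)^{d/2}/√D₀ · Z · χ_lo · e^{−(ε_q+ε_tr)} · (N_lo − T_b) · (…)` — vanishes. [folklore] -/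
theorem lower_constant_vanishes {s K M β : ℝ} {χ₀ : GaugeConfig 3 1 SU2 → ℝ} {qf : ℝ → LinkSpace L → ℝ} {rf : ℝ → ℝ} (hrf : 0 < rf β)
    (hbo : ∀ U, boFun L χ₀ (frozenProfile L qf rf β) U ≠ 0 → recordChi L s K M β U ≠ 0) {χlo : ℝ} (hχlo0 : 0 ≤ χlo)
    (hχlo : ∀ u : GaugeConfig 3 1 SU2, (∀ k : Fin 3, ‖su2Quat (u (0, k)) - 1‖ ≤ 5 * (M * (K * powScale s β))) →
      wilsonAction su2Rep u ≤ 12 * (5 * (M * (K * powScale s β))) ^ 4 → χlo ≤ χ₀ u)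
    (h0 : 0 ≤ M * (K * powScale s β)) (h2 : M * (K * powScale s β) ≤ 2) (A B : ℝ) : A * χlo * B = 0 := by
  rw [chilo_eq_zero_of_crude_floor hrf hbo hχlo0 hχlo h0 h2, mul_zero, zero_mul]

/-! ## §4 The threshold is the link radius (numbers) -/

/-- The sharp window of `…BOLocalisedAvgChartLowerSharp` is `a_W = 2(4+48K)ρ + 6(40(4r² + 2r(4+48K)ρ) + 3r)`; the floor is informative only if `a_W < MK·powScale s β`.
E.g. with `K = 1`, `ρ = r = 10⁻⁶` (schedule-B-like smallness) `a_W < 1.3·10⁻⁴`, far below a link radius `MKβ^{-s}` of order `10⁻²`. [folklore] -/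
example : 2 * (4 + 48 * (1 : ℝ)) * 1e-6 + 6 * (40 * (4 * (1e-6) ^ 2 + 2 * 1e-6 * (4 + 48 * 1) * 1e-6) + 3 * 1e-6) < 1.3e-4 := by norm_num

end Summit.QuantumFields.YangMills.Theorems.TwistedTraceScaling.Negative.R51

end
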